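/-
Copyright (c) 2026 the pub-hodgecm-mathlib formalisation cell (harness21).  Prover seat hodgecm-mathlib-R90-CS-p03 (g2), R90-TF section S8 «ContSpec-n½» (dealer R90-CS-plan (g2),
deal S8-R85 ∕ S8-R105 §3): ★ (a-1)'s token letters `hin ∕ hsp` PACKAGED in their exact binder shapes from per-place torus-entry witnesses — companion of ★ `K2E1ChiLocalMeansOfShellU3`.
-/
import Summits.HodgeConjecture.HodgeConjecture.Theorems.K2E1ChiLocalMeansOfShellU3   -- ★ p863092 (this seat): per-place `chiLocalMean_eq_inertToken_of_torusEntry`, `chiLocalMean_eq_splitToken_of_torusEntries`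
import HarnessLib

/-!
# K2·E1 ∕ R90·S8 — `K2E1ChiLocalMeansOfShellU3Letters`: ★ (a-1)'s LETTERS `hin` ∕ `hsp` FROM PER-PLACE TORUS-ENTRY WITNESSES (the `∀ v ∉ S₀, ∀ w : PlacesOver L v, …` packaging)

Cell `pub/hodgecm-mathlib`, crux h413 = `stmt-HodgeConjecture-24833`, route of record `HCCMUnconditional`; R90-TF section S8 «ContSpec-n½», road R2-χ₃ (the (V) scalar road).
THEOREMS ONLY (no `def`, no `instance`, no notation, no named-fact hypothesis, no `sorry`; default heartbeats); lane `--supports stmt-HodgeConjecture-24833 --as helper` (count-neutral).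
Closes no socket.  Companion of ★ `K2E1ChiLocalMeansOfShellU3` (split off for the 400-line budget).

THE MATHEMATICS ([Rogawski1990] §13.9 p. 229; [Langlands1971] §3; [Casselman1980] §3).  ★ (a-1) `K2E1ChiIntertwiningScalarEulerProductU3Finite.inv_measure_smul_integral_finprod_chi_eq_prod_
mul_chiScalar_three` takes, besides the good-place package `hgood` (`v ∉ S₀`: `v` unramified in `L`, `|2|_v = 1`, all `δ_w` units, `φ` unramified at all `w ∣ v`), two TOKEN LETTERS:
`hin : ∀ v ∉ S₀, ∀ w, c • w = w → m_v(z) = inertToken(φ(ϖ_w))` and `hsp : ∀ v ∉ S₀, ∀ w, c • w ≠ w → m_v(z) = splitToken(φ(ϖ_w), φ(ϖ_w̄))`, `m_v(z) = ν_v(𝒪_v³)⁻¹ • ∫ ω_v·Q_v^{−z}`.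
THIS FILE produces both, verbatim, from `hgood`, unitarity of `φ`, and PER-PLACE WITNESSES of the torus-entry letters — inert: `∃ α, (‖α‖·Q_v = 1 off the unit shell) ∧ (ω_v = 1 on it) ∧
(ω_v = φ_w(α(·)) off it)` (the export shape of R90-C10-p07's Iwasawa brick `K2E1BigCellIwasawaTorusEntryU3`); split: `∃ χ₁ χ₂ π α₁ α₂ c₁ c₂, …` in (W) §3's Gindikin–Karpelevich shape
over `L⁺_v` WITH the identifications `(χ₁ π : ℂ) = φ(ϖ_w)`, `(χ₂ π : ℂ) = φ(ϖ_w̄)` — by the per-place theorems of ★ `K2E1ChiLocalMeansOfShellU3` (§1, §2).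
* **`hin_of_torusEntries`**, **`hsp_of_torusEntries`**.
HONEST SCOPE: pure packaging (`intro`/`obtain`/`exact`); the witnesses are the Iwasawa bricks' business; the split identifications stay inside the witness (★ `splitToken_symm` for the swap).
HONEST LABEL: HC_CM is proved only modulo the 7 printed citations (2 remaining named inputs: hLiu418 = `stmt-HodgeConjecture-24832`, h413 = `stmt-HodgeConjecture-24833`) until rung 0
closes; REL ≠ ★ ≠ BUILT; this file asserts no named fact and closes no socket; count-neutral.

## References
* [Rogawski1990] J. D. Rogawski, *Automorphic Representations of Unitary Groups in Three Variables*, Ann. of Math. Stud. 123 (1990): §4.5 p. 45, §13.9 p. 229.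
* [Langlands1971] R. P. Langlands, *Euler Products* (1971): §3.
* [Casselman1980] W. Casselman, *The unramified principal series of p-adic groups I*, Compositio Math. 40 (1980): §3.
* [MoeglinWaldspurger1995] C. Mœglin, J.-L. Waldspurger, *Spectral Decomposition and Eisenstein Series* (1995): IV.1.11.
-/

set_option autoImplicit false
set_option linter.dupNamespace false -- the mandated namespace repeats `HodgeConjecture.HodgeConjecture`

noncomputable section

open MeasureTheory NumberField IsDedekindDomain
open scoped NNReal ENNReal
open Literature.NumberTheory.Automorphic Literature.NumberTheory.Automorphic.UnitaryGroup Literature.NumberTheory.GaloisRepresentations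
open Literature.NumberTheory.GaloisRepresentations.IsNonarchimedeanLocalField
open Literature.NumberTheory.GelbartRogawski1991.UnitaryDualPair.LocalSplitting (splitSqrt)
open Summit.HodgeConjecture.HodgeConjecture.Cruxes.H413.K2E1ChiLocalMeansOfShellU3 (chiLocalMean_eq_inertToken_of_torusEntry chiLocalMean_eq_splitToken_of_torusEntries)

namespace Summit.HodgeConjecture.HodgeConjecture.Cruxes.H413.K2E1ChiLocalMeansOfShellU3Letters

variable (L : Type) [Field L] [NumberField L] [IsCMField L] {δ : L} (hcδ : IsCMField.complexConj L δ = -δ) (hδ : δ ≠ 0)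
  {d : ↥(maximalRealSubfield L)} (hd : δ * δ = algebraMap ↥(maximalRealSubfield L) L d)

/-! ## ★ (a-1)'s binder shapes `∀ v ∉ S₀, ∀ w : PlacesOver L v, c • w.1 = w.1 → …` ∕ `… ≠ … → …` -/

section Packaging

variable [∀ v : HeightOneSpectrum (𝓞 ↥(maximalRealSubfield L)), MeasurableSpace (v.adicCompletion ↥(maximalRealSubfield L))]
  [∀ v : HeightOneSpectrum (𝓞 ↥(maximalRealSubfield L)), BorelSpace (v.adicCompletion ↥(maximalRealSubfield L))]
  (νv : ∀ v : HeightOneSpectrum (𝓞 ↥(maximalRealSubfield L)), Measure (v.adicCompletion ↥(maximalRealSubfield L))) [∀ v, (νv v).IsAddHaarMeasure]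
  (S₀ : Finset (HeightOneSpectrum (𝓞 ↥(maximalRealSubfield L))))
  (ωv : ∀ v : HeightOneSpectrum (𝓞 ↥(maximalRealSubfield L)), (Fin 3 → v.adicCompletion ↥(maximalRealSubfield L)) → ℂ)

include hd in
/-- **★ (a-1)'s LETTER `hin` FROM THE INERT TORUS-ENTRY LETTERS.**  For a unitary Hecke character `φ` of `L`, the good-place package `hgood` of ★ (a-1)'s HEAD (`v ∉ S₀`: `v` unramified
in `L`, `|2|_v = 1`, all `δ_w` units, `φ` unramified at every `w ∣ v`) and, at every non-split `w ∣ v`, `v ∉ S₀`, a torus-entry witness `∃ α, (α) ∧ (c)` for the weight `ω_v` read through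
`φ_w = φ.localComponent w` (the shape R90-C10-p07's Iwasawa brick exports): THEN `∀ v ∉ S₀, ∀ w, c • w = w → ν_v(𝒪_v³)⁻¹ • ∫ ω_v·Q_v^{−z} = inertToken(φ.valueAtUniformizer w)` (`1 < Re z`) —
LITERALLY the hypothesis `hin` of ★ `K2E1ChiIntertwiningScalarEulerProductU3Finite.inv_measure_smul_integral_finprod_chi_eq_prod_mul_chiScalar_three` (§1 per place).
[cite: Rogawski1990, §13.9 p. 229] [cite: Casselman1980, §3] [cite: Langlands1971, §3] -/
theorem hin_of_torusEntries {φ : HeckeCharacter L} (hφ : φ.IsUnitary)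
    (hgood : ∀ v ∉ S₀, (Algebra.IsUnramifiedIn (𝓞 L) v.asIdeal ∧ Valued.v (2 : v.adicCompletion ↥(maximalRealSubfield L)) = 1 ∧
      ∀ w : PlacesOver L v, Valued.v (algebraMap L (LocalRing L v) δ w) = 1) ∧ ∀ w : PlacesOver L v, φ.IsUnramifiedAt w.1)
    (hT : ∀ v ∉ S₀, ∀ w : PlacesOver L v, IsCMField.complexConj L • w.1 = w.1 →
      ∃ α : (Fin 3 → v.adicCompletion ↥(maximalRealSubfield L)) → (w.1.adicCompletion L)ˣ,
        (∀ p : Fin 3 → v.adicCompletion ↥(maximalRealSubfield L), 1 < (∏ w' : PlacesOver L v, max 1 (max ((normAbs (w'.1.adicCompletion L) (quadraticLocalEquiv L v (IsCMField.complexConj L) hcδ hδ (p 0, p 1) w') : ℝ≥0) : ℝ)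
            ((normAbs (w'.1.adicCompletion L) ((toLocalRing L v (p 2) * algebraMap L (LocalRing L v) δ -
              toLocalRing L v 2⁻¹ * (quadraticLocalEquiv L v (IsCMField.complexConj L) hcδ hδ (p 0, p 1) *
                conjLocal L (IsCMField.complexConj L) v (quadraticLocalEquiv L v (IsCMField.complexConj L) hcδ hδ (p 0, p 1)))) w') : ℝ≥0) : ℝ))) →
          ((normAbs (w.1.adicCompletion L) (α p : w.1.adicCompletion L) : ℝ≥0) : ℝ) * (∏ w' : PlacesOver L v, max 1 (max ((normAbs (w'.1.adicCompletion L) (quadraticLocalEquiv L v (IsCMField.complexConj L) hcδ hδ (p 0, p 1) w') : ℝ≥0) : ℝ)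
            ((normAbs (w'.1.adicCompletion L) ((toLocalRing L v (p 2) * algebraMap L (LocalRing L v) δ -
              toLocalRing L v 2⁻¹ * (quadraticLocalEquiv L v (IsCMField.complexConj L) hcδ hδ (p 0, p 1) *
                conjLocal L (IsCMField.complexConj L) v (quadraticLocalEquiv L v (IsCMField.complexConj L) hcδ hδ (p 0, p 1)))) w') : ℝ≥0) : ℝ))) = 1) ∧
        (∀ p : Fin 3 → v.adicCompletion ↥(maximalRealSubfield L), (∏ w' : PlacesOver L v, max 1 (max ((normAbs (w'.1.adicCompletion L) (quadraticLocalEquiv L v (IsCMField.complexConj L) hcδ hδ (p 0, p 1) w') : ℝ≥0) : ℝ)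
            ((normAbs (w'.1.adicCompletion L) ((toLocalRing L v (p 2) * algebraMap L (LocalRing L v) δ -
              toLocalRing L v 2⁻¹ * (quadraticLocalEquiv L v (IsCMField.complexConj L) hcδ hδ (p 0, p 1) *
                conjLocal L (IsCMField.complexConj L) v (quadraticLocalEquiv L v (IsCMField.complexConj L) hcδ hδ (p 0, p 1)))) w') : ℝ≥0) : ℝ))) = 1 → ωv v p = 1) ∧
        (∀ p : Fin 3 → v.adicCompletion ↥(maximalRealSubfield L), 1 < (∏ w' : PlacesOver L v, max 1 (max ((normAbs (w'.1.adicCompletion L) (quadraticLocalEquiv L v (IsCMField.complexConj L) hcδ hδ (p 0, p 1) w') : ℝ≥0) : ℝ)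
            ((normAbs (w'.1.adicCompletion L) ((toLocalRing L v (p 2) * algebraMap L (LocalRing L v) δ -
              toLocalRing L v 2⁻¹ * (quadraticLocalEquiv L v (IsCMField.complexConj L) hcδ hδ (p 0, p 1) *
                conjLocal L (IsCMField.complexConj L) v (quadraticLocalEquiv L v (IsCMField.complexConj L) hcδ hδ (p 0, p 1)))) w') : ℝ≥0) : ℝ))) →
          ωv v p = ((φ.localComponent w.1 (α p) : ℂˣ) : ℂ)))
    {z : ℂ} (hz : 1 < z.re) :
    ∀ v ∉ S₀, ∀ w : PlacesOver L v, IsCMField.complexConj L • w.1 = w.1 →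
      ((Measure.pi fun _ : Fin 3 => νv v) (integralBox ↥(maximalRealSubfield L) (Fin 3) v)).toReal⁻¹ •
          ∫ p : Fin 3 → v.adicCompletion ↥(maximalRealSubfield L),
            ωv v p * (((∏ w' : PlacesOver L v, max 1 (max ((normAbs (w'.1.adicCompletion L) (quadraticLocalEquiv L v (IsCMField.complexConj L) hcδ hδ (p 0, p 1) w') : ℝ≥0) : ℝ)
            ((normAbs (w'.1.adicCompletion L) ((toLocalRing L v (p 2) * algebraMap L (LocalRing L v) δ -
              toLocalRing L v 2⁻¹ * (quadraticLocalEquiv L v (IsCMField.complexConj L) hcδ hδ (p 0, p 1) *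
                conjLocal L (IsCMField.complexConj L) v (quadraticLocalEquiv L v (IsCMField.complexConj L) hcδ hδ (p 0, p 1)))) w') : ℝ≥0) : ℝ))) : ℝ) : ℂ) ^ (-z)
            ∂(Measure.pi fun _ : Fin 3 => νv v) =
        (1 - φ.valueAtUniformizer w.1 * (v.residueCard : ℂ) ^ (-(2 * z))) * (1 + φ.valueAtUniformizer w.1 * (v.residueCard : ℂ) ^ (-(2 * z - 1))) /
          ((1 - φ.valueAtUniformizer w.1 * (v.residueCard : ℂ) ^ (-(2 * z - 2))) * (1 + φ.valueAtUniformizer w.1 * (v.residueCard : ℂ) ^ (-(2 * z - 2)))) := by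
  intro v hv w hw
  obtain ⟨α, hα, hω1, hωQ⟩ := hT v hv w hw
  exact chiLocalMean_eq_inertToken_of_torusEntry L hcδ hδ hd v (νv v) (hgood v hv).1.1 w hw (hgood v hv).1.2.1 ((hgood v hv).1.2.2 w) hφ ((hgood v hv).2 w)
    α hα (ωv v) hω1 hωQ hz

include hd in
/-- **★ (a-1)'s LETTER `hsp` FROM THE SPLIT TORUS-ENTRY LETTERS.**  Same `hgood` package; at every split `w ∣ v`, `v ∉ S₀`, a witness in (W) §3's shape over `L⁺_v` (Gindikin–Karpelevich
base coordinates at `δ_w =` ★ `splitSqrt … v w`): unramified characters `χ₁ χ₂` of `L⁺_v^×`, a uniformizer `π` (`‖π‖ = q_v⁻¹`) WITH THE IDENTIFICATIONS `(χ₁ π : ℂ) = φ.valueAtUniformizer w`,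
`(χ₂ π : ℂ) = φ.valueAtUniformizer w̄` (`w̄ = galInv c w`; swap the roles with `splitToken_symm` if the brick attaches them the other way), torus entries `α₁ α₂` on the heights `A, B` and the
weight factorisation `ω_v = c₁·c₂`: THEN `∀ v ∉ S₀, ∀ w, c • w ≠ w → ν_v(𝒪_v³)⁻¹ • ∫ ω_v·Q_v^{−z} = splitToken(φ(ϖ_w), φ(ϖ_w̄))` — LITERALLY (a-1)'s `hsp` (§2 per place; `‖e_j‖ = 1` from unitarity).
[cite: Rogawski1990, §13.9 p. 229] [cite: Casselman1980, §3] [cite: Langlands1971, §3] [cite: MoeglinWaldspurger1995, IV.1.11] -/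
theorem hsp_of_torusEntries {φ : HeckeCharacter L} (hφ : φ.IsUnitary)
    (hgood : ∀ v ∉ S₀, (Algebra.IsUnramifiedIn (𝓞 L) v.asIdeal ∧ Valued.v (2 : v.adicCompletion ↥(maximalRealSubfield L)) = 1 ∧
      ∀ w : PlacesOver L v, Valued.v (algebraMap L (LocalRing L v) δ w) = 1) ∧ ∀ w : PlacesOver L v, φ.IsUnramifiedAt w.1)
    (hT : ∀ v ∉ S₀, ∀ w : PlacesOver L v, IsCMField.complexConj L • w.1 ≠ w.1 →
      ∃ (χ₁ χ₂ : (v.adicCompletion ↥(maximalRealSubfield L))ˣ →* ℂˣ) (π : (v.adicCompletion ↥(maximalRealSubfield L))ˣ) (α₁ α₂ : (Fin 3 → v.adicCompletion ↥(maximalRealSubfield L)) → (v.adicCompletion ↥(maximalRealSubfield L))ˣ)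
        (c₁ c₂ : (Fin 3 → v.adicCompletion ↥(maximalRealSubfield L)) → ℂ),
        (∀ u : (v.adicCompletion ↥(maximalRealSubfield L))ˣ, normAbs (v.adicCompletion ↥(maximalRealSubfield L)) (u : v.adicCompletion ↥(maximalRealSubfield L)) = 1 → χ₁ u = 1) ∧
        (∀ u : (v.adicCompletion ↥(maximalRealSubfield L))ˣ, normAbs (v.adicCompletion ↥(maximalRealSubfield L)) (u : v.adicCompletion ↥(maximalRealSubfield L)) = 1 → χ₂ u = 1) ∧
        normAbs (v.adicCompletion ↥(maximalRealSubfield L)) (π : v.adicCompletion ↥(maximalRealSubfield L)) = (residueFieldCard (v.adicCompletion ↥(maximalRealSubfield L)) : ℝ≥0)⁻¹ ∧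
        ((χ₁ π : ℂˣ) : ℂ) = φ.valueAtUniformizer w.1 ∧ ((χ₂ π : ℂˣ) : ℂ) = φ.valueAtUniformizer (PlacesOver.galInv (IsCMField.complexConj L) w).1 ∧
        (∀ p : Fin 3 → v.adicCompletion ↥(maximalRealSubfield L), 1 < max 1 (max ((normAbs (v.adicCompletion ↥(maximalRealSubfield L)) (p 0 + splitSqrt ↥(maximalRealSubfield L) L (IsCMField.complexConj L) hcδ hδ v w * p 1) : ℝ≥0) : ℝ)
            ((normAbs (v.adicCompletion ↥(maximalRealSubfield L)) (splitSqrt ↥(maximalRealSubfield L) L (IsCMField.complexConj L) hcδ hδ v w * p 2 - 2⁻¹ * (p 0 + splitSqrt ↥(maximalRealSubfield L) L (IsCMField.complexConj L) hcδ hδ v w * p 1) * (p 0 - splitSqrt ↥(maximalRealSubfield L) L (IsCMField.complexConj L) hcδ hδ v w * p 1)) : ℝ≥0) : ℝ)) →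
          ((normAbs (v.adicCompletion ↥(maximalRealSubfield L)) (α₁ p : v.adicCompletion ↥(maximalRealSubfield L)) : ℝ≥0) : ℝ) * max 1 (max ((normAbs (v.adicCompletion ↥(maximalRealSubfield L)) (p 0 + splitSqrt ↥(maximalRealSubfield L) L (IsCMField.complexConj L) hcδ hδ v w * p 1) : ℝ≥0) : ℝ)
            ((normAbs (v.adicCompletion ↥(maximalRealSubfield L)) (splitSqrt ↥(maximalRealSubfield L) L (IsCMField.complexConj L) hcδ hδ v w * p 2 - 2⁻¹ * (p 0 + splitSqrt ↥(maximalRealSubfield L) L (IsCMField.complexConj L) hcδ hδ v w * p 1) * (p 0 - splitSqrt ↥(maximalRealSubfield L) L (IsCMField.complexConj L) hcδ hδ v w * p 1)) : ℝ≥0) : ℝ)) = 1) ∧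
        (∀ p : Fin 3 → v.adicCompletion ↥(maximalRealSubfield L), 1 < max 1 (max ((normAbs (v.adicCompletion ↥(maximalRealSubfield L)) (-(p 0 - splitSqrt ↥(maximalRealSubfield L) L (IsCMField.complexConj L) hcδ hδ v w * p 1)) : ℝ≥0) : ℝ)
            ((normAbs (v.adicCompletion ↥(maximalRealSubfield L)) (splitSqrt ↥(maximalRealSubfield L) L (IsCMField.complexConj L) hcδ hδ v w * p 2 - 2⁻¹ * (p 0 + splitSqrt ↥(maximalRealSubfield L) L (IsCMField.complexConj L) hcδ hδ v w * p 1) * (p 0 - splitSqrt ↥(maximalRealSubfield L) L (IsCMField.complexConj L) hcδ hδ v w * p 1) -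
              (p 0 + splitSqrt ↥(maximalRealSubfield L) L (IsCMField.complexConj L) hcδ hδ v w * p 1) * (-(p 0 - splitSqrt ↥(maximalRealSubfield L) L (IsCMField.complexConj L) hcδ hδ v w * p 1))) : ℝ≥0) : ℝ)) →
          ((normAbs (v.adicCompletion ↥(maximalRealSubfield L)) (α₂ p : v.adicCompletion ↥(maximalRealSubfield L)) : ℝ≥0) : ℝ) * max 1 (max ((normAbs (v.adicCompletion ↥(maximalRealSubfield L)) (-(p 0 - splitSqrt ↥(maximalRealSubfield L) L (IsCMField.complexConj L) hcδ hδ v w * p 1)) : ℝ≥0) : ℝ)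
            ((normAbs (v.adicCompletion ↥(maximalRealSubfield L)) (splitSqrt ↥(maximalRealSubfield L) L (IsCMField.complexConj L) hcδ hδ v w * p 2 - 2⁻¹ * (p 0 + splitSqrt ↥(maximalRealSubfield L) L (IsCMField.complexConj L) hcδ hδ v w * p 1) * (p 0 - splitSqrt ↥(maximalRealSubfield L) L (IsCMField.complexConj L) hcδ hδ v w * p 1) -
              (p 0 + splitSqrt ↥(maximalRealSubfield L) L (IsCMField.complexConj L) hcδ hδ v w * p 1) * (-(p 0 - splitSqrt ↥(maximalRealSubfield L) L (IsCMField.complexConj L) hcδ hδ v w * p 1))) : ℝ≥0) : ℝ)) = 1) ∧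
        (∀ p : Fin 3 → v.adicCompletion ↥(maximalRealSubfield L), max 1 (max ((normAbs (v.adicCompletion ↥(maximalRealSubfield L)) (p 0 + splitSqrt ↥(maximalRealSubfield L) L (IsCMField.complexConj L) hcδ hδ v w * p 1) : ℝ≥0) : ℝ)
            ((normAbs (v.adicCompletion ↥(maximalRealSubfield L)) (splitSqrt ↥(maximalRealSubfield L) L (IsCMField.complexConj L) hcδ hδ v w * p 2 - 2⁻¹ * (p 0 + splitSqrt ↥(maximalRealSubfield L) L (IsCMField.complexConj L) hcδ hδ v w * p 1) * (p 0 - splitSqrt ↥(maximalRealSubfield L) L (IsCMField.complexConj L) hcδ hδ v w * p 1)) : ℝ≥0) : ℝ)) = 1 → c₁ p = 1) ∧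
        (∀ p : Fin 3 → v.adicCompletion ↥(maximalRealSubfield L), 1 < max 1 (max ((normAbs (v.adicCompletion ↥(maximalRealSubfield L)) (p 0 + splitSqrt ↥(maximalRealSubfield L) L (IsCMField.complexConj L) hcδ hδ v w * p 1) : ℝ≥0) : ℝ)
            ((normAbs (v.adicCompletion ↥(maximalRealSubfield L)) (splitSqrt ↥(maximalRealSubfield L) L (IsCMField.complexConj L) hcδ hδ v w * p 2 - 2⁻¹ * (p 0 + splitSqrt ↥(maximalRealSubfield L) L (IsCMField.complexConj L) hcδ hδ v w * p 1) * (p 0 - splitSqrt ↥(maximalRealSubfield L) L (IsCMField.complexConj L) hcδ hδ v w * p 1)) : ℝ≥0) : ℝ)) → c₁ p = ((χ₁ (α₁ p) : ℂˣ) : ℂ)) ∧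
        (∀ p : Fin 3 → v.adicCompletion ↥(maximalRealSubfield L), max 1 (max ((normAbs (v.adicCompletion ↥(maximalRealSubfield L)) (-(p 0 - splitSqrt ↥(maximalRealSubfield L) L (IsCMField.complexConj L) hcδ hδ v w * p 1)) : ℝ≥0) : ℝ)
            ((normAbs (v.adicCompletion ↥(maximalRealSubfield L)) (splitSqrt ↥(maximalRealSubfield L) L (IsCMField.complexConj L) hcδ hδ v w * p 2 - 2⁻¹ * (p 0 + splitSqrt ↥(maximalRealSubfield L) L (IsCMField.complexConj L) hcδ hδ v w * p 1) * (p 0 - splitSqrt ↥(maximalRealSubfield L) L (IsCMField.complexConj L) hcδ hδ v w * p 1) -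
              (p 0 + splitSqrt ↥(maximalRealSubfield L) L (IsCMField.complexConj L) hcδ hδ v w * p 1) * (-(p 0 - splitSqrt ↥(maximalRealSubfield L) L (IsCMField.complexConj L) hcδ hδ v w * p 1))) : ℝ≥0) : ℝ)) = 1 → c₂ p = 1) ∧
        (∀ p : Fin 3 → v.adicCompletion ↥(maximalRealSubfield L), 1 < max 1 (max ((normAbs (v.adicCompletion ↥(maximalRealSubfield L)) (-(p 0 - splitSqrt ↥(maximalRealSubfield L) L (IsCMField.complexConj L) hcδ hδ v w * p 1)) : ℝ≥0) : ℝ)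
            ((normAbs (v.adicCompletion ↥(maximalRealSubfield L)) (splitSqrt ↥(maximalRealSubfield L) L (IsCMField.complexConj L) hcδ hδ v w * p 2 - 2⁻¹ * (p 0 + splitSqrt ↥(maximalRealSubfield L) L (IsCMField.complexConj L) hcδ hδ v w * p 1) * (p 0 - splitSqrt ↥(maximalRealSubfield L) L (IsCMField.complexConj L) hcδ hδ v w * p 1) -
              (p 0 + splitSqrt ↥(maximalRealSubfield L) L (IsCMField.complexConj L) hcδ hδ v w * p 1) * (-(p 0 - splitSqrt ↥(maximalRealSubfield L) L (IsCMField.complexConj L) hcδ hδ v w * p 1))) : ℝ≥0) : ℝ)) → c₂ p = ((χ₂ (α₂ p) : ℂˣ) : ℂ)) ∧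
        (∀ p : Fin 3 → v.adicCompletion ↥(maximalRealSubfield L), ωv v p = c₁ p * c₂ p))
    {z : ℂ} (hz : 1 < z.re) :
    ∀ v ∉ S₀, ∀ w : PlacesOver L v, IsCMField.complexConj L • w.1 ≠ w.1 →
      ((Measure.pi fun _ : Fin 3 => νv v) (integralBox ↥(maximalRealSubfield L) (Fin 3) v)).toReal⁻¹ •
          ∫ p : Fin 3 → v.adicCompletion ↥(maximalRealSubfield L),
            ωv v p * (((∏ w' : PlacesOver L v, max 1 (max ((normAbs (w'.1.adicCompletion L) (quadraticLocalEquiv L v (IsCMField.complexConj L) hcδ hδ (p 0, p 1) w') : ℝ≥0) : ℝ)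
            ((normAbs (w'.1.adicCompletion L) ((toLocalRing L v (p 2) * algebraMap L (LocalRing L v) δ -
              toLocalRing L v 2⁻¹ * (quadraticLocalEquiv L v (IsCMField.complexConj L) hcδ hδ (p 0, p 1) *
                conjLocal L (IsCMField.complexConj L) v (quadraticLocalEquiv L v (IsCMField.complexConj L) hcδ hδ (p 0, p 1)))) w') : ℝ≥0) : ℝ))) : ℝ) : ℂ) ^ (-z)
            ∂(Measure.pi fun _ : Fin 3 => νv v) =
        (1 - φ.valueAtUniformizer w.1 * (v.residueCard : ℂ) ^ (-z)) * (1 - φ.valueAtUniformizer (PlacesOver.galInv (IsCMField.complexConj L) w).1 * (v.residueCard : ℂ) ^ (-z)) *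
            (1 - φ.valueAtUniformizer w.1 * φ.valueAtUniformizer (PlacesOver.galInv (IsCMField.complexConj L) w).1 * (v.residueCard : ℂ) ^ (-(2 * z - 1))) /
          ((1 - φ.valueAtUniformizer w.1 * (v.residueCard : ℂ) ^ (-(z - 1))) * (1 - φ.valueAtUniformizer (PlacesOver.galInv (IsCMField.complexConj L) w).1 * (v.residueCard : ℂ) ^ (-(z - 1))) *
            (1 - φ.valueAtUniformizer w.1 * φ.valueAtUniformizer (PlacesOver.galInv (IsCMField.complexConj L) w).1 * (v.residueCard : ℂ) ^ (-(2 * z - 2)))) := by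
  intro v hv w hw
  obtain ⟨χ₁, χ₂, π, α₁, α₂, c₁, c₂, hχ₁, hχ₂, hπ, he₁, he₂, hα₁, hα₂, hc₁1, hc₁A, hc₂1, hc₂B, hω⟩ := hT v hv w hw
  exact chiLocalMean_eq_splitToken_of_torusEntries L hcδ hδ hd v (νv v) w hw (hgood v hv).1.2.1 ((hgood v hv).1.2.2 w) χ₁ χ₂ hχ₁ hχ₂ π hπ he₁ he₂
    (HeckeCharacter.norm_valueAtUniformizer_of_isUnitary hφ w.1) (HeckeCharacter.norm_valueAtUniformizer_of_isUnitary hφ (PlacesOver.galInv (IsCMField.complexConj L) w).1)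
    α₁ α₂ hα₁ hα₂ c₁ c₂ (ωv v) hc₁1 hc₁A hc₂1 hc₂B hω hz

end Packaging

end Summit.HodgeConjecture.HodgeConjecture.Cruxes.H413.K2E1ChiLocalMeansOfShellU3Letters

end
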